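import Summits.PneNP.PneNP.Theorems.SoloBlindStreamingCodes
import Summits.PneNP.PneNP.Theorems.SoloBlindAnchor
import Literature.Computability.Complexity.SearchToDecision
import Literature.Computability.Complexity.TM2While
import Literature.Computability.Complexity.Williams2014AccWitnesses
import Literature.Computability.Complexity.UniversalWitnessCircuitsHardInputs
import HarnessLib

/-!
# Fact-free uniform hardness magnification for `MCSP[s]` — THEOREM A (soloist, blind arm)

This file closes the construction begun in `SoloBlindConsistentStreaming` (the abstract
consistent-program streaming algorithm) and `SoloBlindStreamingCodes` (all of its maps computed
on codes): it builds the explicit-time TM2 machines, chooses the selector by the tree's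
search-to-decision theorem under `NP ⊆ P`, and assembles

* `CStream.mem_USTREAM_of_NP_subset_P` — if `NP ⊆ P`, `n ≤ s n ≤ 5 · 2ⁿ` and `s` is computed on
  codes from unary inputs, then `MCSP[s] ∈ USTREAM (s(log N)^c + c) (N^c + c)` for some `c`;
* `MCSPSize_mem_USTREAM_of_P_eq_NP` — the same for every `s` with `n ≤ s n` (the cap at
  `5 · 2ⁿ` is harmless: every Boolean function has a circuit of that size);
* **THEOREM A** `pneNP_of_uniformStreamingLowerBound` — a *kernel-checked* weak uniform
  magnification theorem: if for every `c` the language `MCSP[s]` has no uniform one-pass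
  streaming algorithm with `s(log N)^c + c` space and `N^c + c` update/report time, then
  `P ≠ NP` (`PneNP`). No named fact is consumed (compare `pneNP_of_streamingLowerBound`, which
  consumes McKay–Murray–Williams' Theorem 1.3 as the named fact `thm13` and allows update time
  `poly(s(log N))`; the present hypothesis asks for a lower bound against update time `poly(N)`,
  hence is *stronger* as a hypothesis and the theorem correspondingly weaker — but for lower
  bounds proved by communication-complexity or space arguments the two hypotheses coincide).

The update machine is the composite "pad, loop, core": a `CodeFP` pre-stage writes the loop
word `⟨flag, 1^i, u⟩`, the `while` machine of `TM2While` iterates the `CodeFP` step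
`i ↦ i + 1` until the flag `N ≤ i` is raised (exactly `N` rounds, each polynomial in the word
length), and the `CodeFP` core then evaluates the padded update `updateP s g N N σ b`, whose
input now has length `≥ N`, so that "polynomial in the input" means "polynomial in `N`".

References: McKay–Murray–Williams, *Weak lower bounds on resource-bounded compression imply
strong separations of complexity classes*, STOC 2019, Thm. 1.3 and §5 (the magnification
statement and the search-to-decision idea); Arora–Barak 2009, §1.3–1.4 and Thm. 2.18
(machine composition, the universal loop, search-to-decision under `P = NP`).
-/

namespace Summit.PneNP.PneNP.Theorems.SoloBlind

open Computability Polynomial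
open Literature.Computability.Complexity Literature.Computability.Complexity.CircEval
open Literature.Computability.Complexity.CodeFP (natE unE bitE pairE rawE strE unitE pairE_apply
  unE_eq_ones length_unE length_natE_le)
open Literature.Computability.MetaComplexity Literature.Computability.MetaComplexity.MCSPVerif
open Literature.Computability.MetaComplexity.McKayMurrayWilliams2019

namespace CStream

/-! ### Arithmetic -/

/-- A fixed quadratic is below `x ^ 61 + 61`. [folklore] -/
theorem quad_le_pow (x : ℕ) : 16 * x ^ 2 + 28 * x + 15 ≤ x ^ 61 + 61 := by
  rcases Nat.lt_or_ge x 2 with hx | hx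
  · interval_cases x <;> norm_num
  · have h1 : 16 * x ^ 2 + 28 * x + 15 ≤ 59 * x ^ 2 := by nlinarith
    have h2 : 59 ≤ x ^ 6 := le_trans (by norm_num) (Nat.pow_le_pow_left hx 6)
    have h3 : x ^ 6 * x ^ 2 ≤ x ^ 61 := by
      rw [← pow_add]; exact Nat.pow_le_pow_right (by omega) (by norm_num)
    nlinarith

/-- The state-length parameter `K` is quadratic in `N` once `s n ≤ 5 · 2ⁿ`. [folklore] -/
theorem K_le_sq {s : ℕ → ℕ} (hs5 : ∀ n, s n ≤ 5 * 2 ^ n) (N : ℕ) :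
    K s (Nat.log 2 N) ≤ 348 * (N + 1) ^ 2 := by
  have hM : 2 ^ Nat.log 2 N ≤ N + 1 := by
    rcases Nat.eq_zero_or_pos N with rfl | hN
    · simp
    · exact (Nat.pow_log_le_self 2 hN.ne').trans (Nat.le_succ N)
  have hn : Nat.log 2 N ≤ N + 1 := Nat.lt_two_pow_self.le.trans hM
  have hsn : s (Nat.log 2 N) ≤ 5 * (N + 1) := (hs5 _).trans (Nat.mul_le_mul_left 5 hM)
  unfold K
  calc (s (Nat.log 2 N) + 1) * (8 * (Nat.log 2 N + s (Nat.log 2 N)) + 10)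
      ≤ (5 * (N + 1) + 1) * (8 * ((N + 1) + 5 * (N + 1)) + 10) := by gcongr
    _ ≤ 348 * (N + 1) ^ 2 := by nlinarith

/-- The space bound of the algorithm is polynomial in `s (log N)` when `n ≤ s n`. [folklore] -/
theorem space_le_pow {s : ℕ → ℕ} (hs : ∀ n, n ≤ s n) (N : ℕ) :
    2 * N.size + K s (Nat.log 2 N) + 3 ≤ s (Nat.log 2 N) ^ 61 + 61 := by
  have hsz : N.size ≤ Nat.log 2 N + 1 := Nat.size_le.2 (Nat.lt_pow_succ_log_self one_lt_two N)
  have hn := hs (Nat.log 2 N)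
  refine le_trans ?_ (quad_le_pow (s (Nat.log 2 N)))
  unfold K
  calc 2 * N.size + (s (Nat.log 2 N) + 1) * (8 * (Nat.log 2 N + s (Nat.log 2 N)) + 10) + 3
      ≤ 2 * (s (Nat.log 2 N) + 1)
          + (s (Nat.log 2 N) + 1) * (8 * (s (Nat.log 2 N) + s (Nat.log 2 N)) + 10) + 3 := by
        gcongr; omega
    _ = 16 * s (Nat.log 2 N) ^ 2 + 28 * s (Nat.log 2 N) + 15 := by ring

/-! ### Capping the size bound at `5 · 2ⁿ` -/

/-- Every Boolean function on `n` inputs has `B₂`-circuit complexity at most `5 · 2ⁿ` (the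
universal multiplexer circuit).
[cite: AroraBarak2009, Claim 6.7 (every function has a circuit of size O(n 2^n))] -/
theorem circuitSizeOver_le_cap {n : ℕ} (f : (Fin n → Bool) → Bool) :
    circuitSizeOver B2 f ≤ 5 * 2 ^ n := by
  obtain ⟨C, hB, hsize, heval⟩ := (cktSize_univ_fin n (fun x _ => f x)).toCircuit
  exact (circuitSizeOver_le_of_computes C hB (fun x => heval x)).trans
    (hsize.trans (by have := univBound_le n; omega))

/-- Capping the size bound at `5 · 2ⁿ` does not change `MCSP[s]`. [folklore] -/
theorem MCSPSize_cap (s : ℕ → ℕ) : MCSPSize (fun n => min (s n) (5 * 2 ^ n)) = MCSPSize s := by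
  ext w
  simp only [MCSPSize, le_min_iff]
  exact ⟨fun ⟨n, f, hw, h1, _⟩ => ⟨n, f, hw, h1⟩,
    fun ⟨n, f, hw, h1⟩ => ⟨n, f, hw, h1, circuitSizeOver_le_cap f⟩⟩

/-- The capped size bound is again computed on codes from unary inputs.
[cite: AroraBarak2009, §1.3] -/
theorem cf_cap {s : ℕ → ℕ} (hsC : CodeFP unE natE s) :
    CodeFP unE natE (fun n => min (s n) (5 * 2 ^ n)) :=
  (CodeFP.natMin.comp (hsC.pair (CodeFP.natMul.comp ((CodeFP.const unE 5).pair
    (CodeFP.natPow.comp ((CodeFP.const unE 2).pair (CodeFP.id unE))))))).congr fun _ => rfl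

/-! ### The selector under `NP ⊆ P` -/

/-- A good program is admissible, hence of length at most `K`. [folklore] -/
theorem length_le_of_good (s : ℕ → ℕ) {N j : ℕ} {D : List Bool} {b : Bool} {D' : List Bool}
    (h : Good s N j D b D' = true) : D'.length ≤ K s (Nat.log 2 N) :=
  (((adm_iff s _ _).1 ((good_iff s N j D b D').1 h).1).2.2.2)

/-- The padded instance `⟨1^N, N, j, D, b⟩` has length at least `2N + 2`. [folklore] -/
theorem length_instE_ge (N j : ℕ) (D : List Bool) (b : Bool) :
    2 * N + 2 ≤ (instE (N, N, j, D, b)).length := by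
  show 2 * N + 2 ≤ (boolPair (unE N) _).length
  rw [length_boolPair, length_unE]; omega

/-- **The selector.** If `NP ⊆ P` (and `s n ≤ 5 · 2ⁿ` is computed on codes), there is a string
function `g ∈ FP` whose induced selector `selN g` returns a good successor program whenever one
exists: apply the tree's search-to-decision theorem (`exists_searchFn_of_NP_subset_P`) to the
polynomial-time relation "`D'` is good for the padded instance", with witness-length polynomial
`400 (X + 1)²`, which dominates `K` on padded instances.
[cite: AroraBarak2009, Thm. 2.18]
[cite: McKayMurrayWilliams2019, Thm. 1.3 (proof, the P = NP oracle step)] -/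
theorem exists_selector {s : ℕ → ℕ} (hNP : Nondeterministic.NP ⊆ Classes.P)
    (hs5 : ∀ n, s n ≤ 5 * 2 ^ n) (hsC : CodeFP unE natE s) :
    ∃ g ∈ FP, ∀ N j D b D₀, Good s N j D b D₀ = true → Good s N j D b (selN g N j D b) = true := by
  obtain ⟨G, hG, hGspec⟩ := cf_goodP hsC
  have hR : ({z | G z = (fun _ : List Bool => [true]) z} : Language Bool) ∈ Classes.P :=
    setOf_apply_eq_apply_mem_P hG (const_mem_FP [true])
  obtain ⟨g, hg, hspec⟩ :=
    exists_searchFn_of_NP_subset_P hNP hR (400 * (X + 1) ^ 2 : Polynomial ℕ)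
  refine ⟨g, hg, fun N j D b D₀ hD₀ => ?_⟩
  have hmem : ∀ D' : List Bool,
      boolPair (instE (N, N, j, D, b)) D' ∈ ({z | G z = (fun _ : List Bool => [true]) z} :
        Language Bool) ↔ GoodP s N N j D b D' = true := fun D' => by
    show G (pairE instE strE ((N, N, j, D, b), D')) = [true] ↔ _
    rw [hGspec]
    show bitE _ = [true] ↔ _
    simp [bitE]
  have hp : ∀ L : ℕ, (400 * (X + 1) ^ 2 : Polynomial ℕ).eval L = 400 * (L + 1) ^ 2 := fun L => by
    simp [eval_pow]
  have hK : K s (Nat.log 2 N) ≤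
      (400 * (X + 1) ^ 2 : Polynomial ℕ).eval (instE (N, N, j, D, b)).length := by
    rw [hp]
    have h1 := K_le_sq hs5 N
    have h2 := length_instE_ge N j D b
    generalize (instE (N, N, j, D, b)).length = L at h2 ⊢
    generalize K s (Nat.log 2 N) = k at h1 ⊢
    have h3 : (2 * N + 2 + 1) ^ 2 ≤ (L + 1) ^ 2 := Nat.pow_le_pow_left (by omega) 2
    nlinarith [h3]
  have hlen : D₀.length ≤ (400 * (X + 1) ^ 2 : Polynomial ℕ).eval (instE (N, N, j, D, b)).length :=
    (length_le_of_good s hD₀).trans hK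
  have h := (hspec (instE (N, N, j, D, b))
    ⟨D₀, hlen, (hmem D₀).2 (by rw [goodP_self]; exact hD₀)⟩).2
  have h' := (hmem _).1 h
  rwa [goodP_self] at h'

/-! ### The padded update machine with explicit running time -/

/-- The flag carried by the loop word after `i` rounds: raised iff `N ≤ i` (and down at the
start). [folklore] -/
def fl (N : ℕ) : ℕ → Bool
  | 0 => false
  | i + 1 => decide (N ≤ i + 1)

/-- The orbit of the padding loop on update input `u = (N, σ, b)`: the words
`⟨flag, 1^i, u⟩`. [folklore] -/
def orbit (u : UIn) (i : ℕ) : List Bool := wE (fl u.1 i, i, u)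

/-- The loop word starts with two copies of its flag. [folklore] -/
theorem orbit_eq_cons (u : UIn) (i : ℕ) :
    orbit u i = fl u.1 i :: fl u.1 i :: false :: true :: boolPair (unE i) (uE u) := rfl

/-- Length of the loop word. [folklore] -/
theorem length_orbit (u : UIn) (i : ℕ) : (orbit u i).length = 2 * i + 6 + (uE u).length := by
  rw [orbit_eq_cons]
  simp only [List.length_cons, length_boolPair, length_unE]
  omega

/-- Length of the coded update input. [folklore] -/
theorem length_uE (N : ℕ) (σ : List Bool) (b : Bool) :
    (uE (N, σ, b)).length = 2 * (natE N).length + 2 * σ.length + 5 := by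
  show (boolPair (natE N) (boolPair σ [b])).length = _
  simp only [length_boolPair, List.length_singleton]
  omega

/-- **The padded update machine.** For every size bound computed on codes and every string
selector `g ∈ FP` there is a TM2 machine computing `σ, b ↦ updateP s g N N σ b` on the update
input `⟨N, ⟨σ, b⟩⟩` within `q(N + |σ|)` steps, for a fixed polynomial `q`: pre-stage, `N` rounds
of the `while` machine over the words `⟨flag, 1^i, u⟩`, then the core stage on the padded word.
[cite: AroraBarak2009, §1.3–1.4 (composition of machines; running a machine in a loop)] -/
theorem exists_updateMachine {s : ℕ → ℕ} (hsC : CodeFP unE natE s) {g : List Bool → List Bool}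
    (hg : g ∈ FP) :
    ∃ (M : Turing.TM2ComputableAux Bool Bool) (q : Polynomial ℕ),
      ∀ (N : ℕ) (σ : List Bool) (b : Bool), 1 ≤ N →
        M.OutputsWithin (boolPair (encodeNat N) (boolPair σ [b])) (updateP s g N N σ b)
          (q.eval (N + σ.length)) := by
  obtain ⟨p₁, M₁, h₁⟩ := cf_padInit.polyTimeComputable
  obtain ⟨p₂, M₂, h₂⟩ := cf_padStep.polyTimeComputable
  obtain ⟨p₃, M₃, h₃⟩ := (cf_padCore hsC hg).polyTimeComputable
  refine ⟨(M₁.comp (TM2While.whileAux M₂ fun a : Bool => a)).comp M₃,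
    (X * (p₁ + p₂ + p₃ + 2 * X + 2)).comp (4 * X + 11), fun N σ b hN => ?_⟩
  obtain ⟨n, rfl⟩ : ∃ n, N = n + 1 := ⟨N - 1, by omega⟩
  -- stage 1: write the loop word
  have H1 : M₁.OutputsWithin (uE (n + 1, σ, b)) (orbit (n + 1, σ, b) 0)
      (p₁.eval (uE (n + 1, σ, b)).length) := h₁ (n + 1, σ, b)
  -- stage 2: the loop
  have hrun : ∀ i ≤ n, M₂.OutputsWithin (orbit (n + 1, σ, b) i) (orbit (n + 1, σ, b) (i + 1))
      (p₂.eval (orbit (n + 1, σ, b) i).length) :=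
    fun i _ => h₂ (fl (n + 1) i, i, (n + 1, σ, b))
  have hgo : ∀ i < n, ∃ a rest, orbit (n + 1, σ, b) (i + 1) = a :: rest ∧
      (fun a : Bool => a) a = false :=
    fun i hi => ⟨_, _, orbit_eq_cons _ (i + 1), by simp [fl]; omega⟩
  have hstop : ∃ a rest, orbit (n + 1, σ, b) (n + 1) = a :: rest ∧ (fun a : Bool => a) a = true :=
    ⟨_, _, orbit_eq_cons _ (n + 1), by simp [fl]⟩
  have H2 := TM2While.whileAux_outputsWithin M₂ (fun a : Bool => a) n (orbit (n + 1, σ, b))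
    (fun i => p₂.eval (orbit (n + 1, σ, b) i).length) hrun hgo hstop
  -- stage 3: the core
  have H3 : M₃.OutputsWithin (orbit (n + 1, σ, b) (n + 1)) (updateP s g (n + 1) (n + 1) σ b)
      (p₃.eval (orbit (n + 1, σ, b) (n + 1)).length) :=
    h₃ (fl (n + 1) (n + 1), n + 1, (n + 1, σ, b))
  have H := Turing.TM2ComputableAux.comp_outputsWithin _ _
    (Turing.TM2ComputableAux.comp_outputsWithin _ _ H1 H2) H3
  refine H.mono ?_
  -- the time bound
  set L := (uE (n + 1, σ, b)).length with hL
  set Lw := 2 * (n + 1) + 6 + L with hLw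
  have hol : ∀ i ≤ n + 1, (orbit (n + 1, σ, b) i).length ≤ Lw := fun i hi => by
    rw [length_orbit]; omega
  have hsum : ∑ i ∈ Finset.range (n + 1), (p₂.eval (orbit (n + 1, σ, b) i).length
      + 2 * (orbit (n + 1, σ, b) (i + 1)).length + 2) ≤ (n + 1) * (p₂.eval Lw + 2 * Lw + 2) := by
    have h := Finset.sum_le_card_nsmul (Finset.range (n + 1))
      (fun i => p₂.eval (orbit (n + 1, σ, b) i).length
        + 2 * (orbit (n + 1, σ, b) (i + 1)).length + 2) (p₂.eval Lw + 2 * Lw + 2)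
      (fun i hi => by
        rw [Finset.mem_range] at hi
        have ho1 := TM2Iter.eval_mono p₂ (hol i (by omega))
        have ho2 := hol (i + 1) (by omega)
        omega)
    simpa using h
  have hp1 : p₁.eval L ≤ p₁.eval Lw := TM2Iter.eval_mono p₁ (by omega)
  have hp3 : p₃.eval (orbit (n + 1, σ, b) (n + 1)).length ≤ p₃.eval Lw :=
    TM2Iter.eval_mono p₃ (hol (n + 1) le_rfl)
  have hLw1 : n + 1 ≤ Lw := by omega
  have hq : (X * (p₁ + p₂ + p₃ + 2 * X + 2) : Polynomial ℕ).eval Lw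
      = Lw * (p₁.eval Lw + p₂.eval Lw + p₃.eval Lw + 2 * Lw + 2) := by
    simp [eval_mul, eval_add]
  have hLσ : Lw ≤ 4 * (n + 1 + σ.length) + 11 := by
    have := length_uE (n + 1) σ b
    have := length_natE_le (n + 1)
    omega
  have hcomp : ((X * (p₁ + p₂ + p₃ + 2 * X + 2)).comp (4 * X + 11) : Polynomial ℕ).eval
      (n + 1 + σ.length) = (X * (p₁ + p₂ + p₃ + 2 * X + 2) : Polynomial ℕ).eval
        (4 * (n + 1 + σ.length) + 11) := by
    simp [eval_comp, eval_mul, eval_add]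
  rw [hcomp]
  refine le_trans ?_ (TM2Iter.eval_mono _ hLσ)
  rw [hq]
  calc p₃.eval (orbit (n + 1, σ, b) (n + 1)).length
        + (∑ i ∈ Finset.range (n + 1), (p₂.eval (orbit (n + 1, σ, b) i).length
            + 2 * (orbit (n + 1, σ, b) (i + 1)).length + 2) + p₁.eval L)
      ≤ p₃.eval Lw + ((n + 1) * (p₂.eval Lw + 2 * Lw + 2) + p₁.eval Lw) := by
        gcongr
    _ ≤ Lw * p₃.eval Lw + (Lw * (p₂.eval Lw + 2 * Lw + 2) + Lw * p₁.eval Lw) := by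
        gcongr
        · exact Nat.le_mul_of_pos_left _ (by omega)
        · exact Nat.le_mul_of_pos_left _ (by omega)
    _ = Lw * (p₁.eval Lw + p₂.eval Lw + p₃.eval Lw + 2 * Lw + 2) := by ring

/-! ### Assembly: `MCSP[s] ∈ USTREAM` under `NP ⊆ P` -/

/-- **Uniform streaming upper bound for `MCSP[s]` under `NP ⊆ P`.** If `NP ⊆ P`,
`n ≤ s n ≤ 5 · 2ⁿ` and `s` is computed on codes from unary inputs, then for some `c` the
language `MCSP[s]` is decided by a uniform one-pass streaming algorithm with `s(log N)^c + c`
space and `N^c + c` update and report time.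
[cite: McKayMurrayWilliams2019, Thm. 1.3 (contrapositive direction of the proof)] -/
theorem mem_USTREAM_of_NP_subset_P {s : ℕ → ℕ} (hNP : Nondeterministic.NP ⊆ Classes.P)
    (hs : ∀ n, n ≤ s n) (hs5 : ∀ n, s n ≤ 5 * 2 ^ n) (hsC : CodeFP unE natE s) :
    ∃ c : ℕ, MCSPSize s ∈ USTREAM (fun N => s (Nat.log 2 N) ^ c + c) (fun N => N ^ c + c) := by
  obtain ⟨g, hg, hsel⟩ := exists_selector hNP hs5 hsC
  obtain ⟨Mu, q, hMu⟩ := exists_updateMachine hsC hg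
  obtain ⟨p₄, M₄, h₄⟩ := cf_accept.polyTimeComputable
  have hSpace : RunsInSpace (alg s (selN g)) (fun N => 2 * N.size + K s (Nat.log 2 N) + 3) :=
    alg_runsInSpace s (selN g)
  -- membership with the raw bounds
  have hmem : MCSPSize s ∈ USTREAM (fun N => 2 * N.size + K s (Nat.log 2 N) + 3)
      (fun N => q.eval (N + (2 * N.size + K s (Nat.log 2 N) + 3))
        + p₄.eval (2 * N + 2 + (2 * N.size + K s (Nat.log 2 N) + 3))) := by
    refine ⟨alg s (selN g), alg_init s (selN g), hSpace, ⟨Mu, fun N x b hx => ?_⟩,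
      ⟨M₄, fun x => ?_⟩, alg_decides s (selN g) hs hsel⟩
    · have hσ : (reach (alg s (selN g)) N x).length ≤ 2 * N.size + K s (Nat.log 2 N) + 3 :=
        hSpace N x hx.le
      have h := hMu N (reach (alg s (selN g)) N x) b (by omega)
      rw [reach_append_singleton, alg_update, ← updateP_self]
      exact h.mono ((TM2Iter.eval_mono q (by omega)).trans (Nat.le_add_right _ _))
    · have hσ : ((alg s (selN g)).finalState x).length
          ≤ 2 * x.length.size + K s (Nat.log 2 x.length) + 3 := by
        rw [finalState_eq_reach]; exact hSpace _ x le_rfl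
      have h := h₄ (x.length, (alg s (selN g)).finalState x)
      have hin : (pairE natE strE (x.length, (alg s (selN g)).finalState x)).length
          ≤ 2 * x.length + 2 + (2 * x.length.size + K s (Nat.log 2 x.length) + 3) := by
        show (boolPair (natE x.length) ((alg s (selN g)).finalState x)).length ≤ _
        rw [length_boolPair]
        have := length_natE_le x.length
        omega
      exact h.mono ((TM2Iter.eval_mono p₄ hin).trans (Nat.le_add_left _ _))
  -- polynomial bounds
  have hSb : ∀ N, 2 * N.size + K s (Nat.log 2 N) + 3 ≤ (405 * (X + 1) ^ 2 : Polynomial ℕ).eval N :=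
    fun N => by
    have h1 : N.size ≤ N := Nat.size_le.2 Nat.lt_two_pow_self
    have h2 := K_le_sq hs5 N
    have e : (405 * (X + 1) ^ 2 : Polynomial ℕ).eval N = 405 * (N + 1) ^ 2 := by simp [eval_pow]
    rw [e]
    nlinarith
  obtain ⟨c₁, hc₁⟩ := exists_eval_le_pow_add_self
    (q.comp (X + 405 * (X + 1) ^ 2) + p₄.comp (2 * X + 2 + 405 * (X + 1) ^ 2))
  have hT : ∀ N, q.eval (N + (2 * N.size + K s (Nat.log 2 N) + 3))
      + p₄.eval (2 * N + 2 + (2 * N.size + K s (Nat.log 2 N) + 3)) ≤ N ^ (c₁ + 61) + (c₁ + 61) :=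
    fun N => by
    refine le_trans ?_ ((hc₁ N).trans (pow_add_self_mono N (Nat.le_add_right c₁ 61)))
    have e : (q.comp (X + 405 * (X + 1) ^ 2) + p₄.comp (2 * X + 2 + 405 * (X + 1) ^ 2) :
        Polynomial ℕ).eval N = q.eval (N + (405 * (X + 1) ^ 2 : Polynomial ℕ).eval N)
          + p₄.eval (2 * N + 2 + (405 * (X + 1) ^ 2 : Polynomial ℕ).eval N) := by
      simp [eval_comp, eval_pow]
    rw [e]
    exact Nat.add_le_add (TM2Iter.eval_mono q (by have := hSb N; omega))
      (TM2Iter.eval_mono p₄ (by have := hSb N; omega))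
  have hS : ∀ N, 2 * N.size + K s (Nat.log 2 N) + 3 ≤ s (Nat.log 2 N) ^ (c₁ + 61) + (c₁ + 61) :=
    fun N => (space_le_pow hs N).trans (pow_add_self_mono _ (Nat.le_add_left 61 c₁))
  exact ⟨c₁ + 61, USTREAM_mono hS hT hmem⟩

end CStream

/-! ### THEOREM A -/

/-- **`P = NP` puts `MCSP[s]` into a small uniform streaming class.** If `P = NP`, then for
every size bound `s` with `n ≤ s n` that is computed on codes from unary inputs (in
particular every time-constructible bound given by an `FP` function on `1ⁿ`), there is a `c`
with `MCSP[s] ∈ USTREAM (s(log N)^c + c) (N^c + c)`.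
[cite: McKayMurrayWilliams2019, Thm. 1.3 (proof)] -/
theorem MCSPSize_mem_USTREAM_of_P_eq_NP (h : Classes.P = Nondeterministic.NP) {s : ℕ → ℕ}
    (hs : ∀ n, n ≤ s n) (hsC : CodeFP unE natE s) :
    ∃ c : ℕ, MCSPSize s ∈ USTREAM (fun N => s (Nat.log 2 N) ^ c + c) (fun N => N ^ c + c) := by
  have hNP : Nondeterministic.NP ⊆ Classes.P := fun L hL => by rw [h]; exact hL
  have h5 : ∀ n : ℕ, n ≤ 5 * 2 ^ n := fun n =>
    Nat.lt_two_pow_self.le.trans (Nat.le_mul_of_pos_left _ (by norm_num))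
  obtain ⟨c, hc⟩ := CStream.mem_USTREAM_of_NP_subset_P (s := fun n => min (s n) (5 * 2 ^ n)) hNP
    (fun n => le_min (hs n) (h5 n)) (fun n => min_le_right _ _) (CStream.cf_cap hsC)
  rw [CStream.MCSPSize_cap] at hc
  exact ⟨c, USTREAM_mono
    (fun N => Nat.add_le_add_right (Nat.pow_le_pow_left (min_le_left _ _) c) c)
    (fun N => le_rfl) hc⟩

/-- **THEOREM A (fact-free weak uniform hardness magnification for `MCSP[s]`).** Let `s` be a
size bound with `n ≤ s n` that is computed on codes from unary inputs. If for every `c` the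
language `MCSP[s]` is *not* decided by a uniform one-pass streaming algorithm with
`s(log N)^c + c` space and `N^c + c` update/report time, then `P ≠ NP`. Kernel-checked; no
named fact is consumed. [cite: McKayMurrayWilliams2019, Thm. 1.3] -/
theorem pneNP_of_uniformStreamingLowerBound {s : ℕ → ℕ} (hs : ∀ n, n ≤ s n)
    (hsC : CodeFP unE natE s)
    (hlb : ∀ c : ℕ, MCSPSize s ∉
      USTREAM (fun N => s (Nat.log 2 N) ^ c + c) (fun N => N ^ c + c)) : PneNP := by
  rw [pneNP_iff_P_ne_NP]
  intro h
  obtain ⟨c, hc⟩ := MCSPSize_mem_USTREAM_of_P_eq_NP h hs hsC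
  exact hlb c hc

/-- The hypothesis of THEOREM A in the tree's `FP` vocabulary: `s` is given by a polynomial-time
string function on unary inputs. [folklore] -/
theorem pneNP_of_uniformStreamingLowerBound' {s : ℕ → ℕ} (hs : ∀ n, n ≤ s n)
    (hsFP : ∃ f ∈ FP, ∀ n, f (ones n) = encodeNat (s n))
    (hlb : ∀ c : ℕ, MCSPSize s ∉
      USTREAM (fun N => s (Nat.log 2 N) ^ c + c) (fun N => N ^ c + c)) : PneNP := by
  obtain ⟨f, hf, hfs⟩ := hsFP
  exact pneNP_of_uniformStreamingLowerBound hs ⟨f, hf, fun n => by rw [unE_eq_ones]; exact hfs n⟩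
    hlb

end Summit.PneNP.PneNP.Theorems.SoloBlind
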